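import Summits.ResolutionOfSingularities.ResolutionOfSingularities.Theorems.NearExitGeom
import Literature.AlgebraicGeometry.Resolution.BlowupChartRsop

/-!
# NearExit (S3) — from the local ring of a near point to the fibre chart: the fibre map, the fibre prime,
# clearing denominators and killing `X₀`

Node «NearExit» of `decomp-res-lens-2` (g33).  `R` local with `𝔪 = (c₀, …, c_d)` quasi-regular, residue field
`κ`; `S = chartRing c j` the `j`-th Rees chart of the blow-up of `𝔪`, `e_k = chartGen c j k` (`c_k = c_j e_k`).
* `fibreMap` («`φ₀`»): `S ↠ S/(c_j) ≅ (R/(c))[X_k : k ≠ j] ≅ κ[X_k : k ≠ j] = F` (the tree's `chartQuotEquiv`, transported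
  along `R/(c) = R/𝔪 = κ`); `φ₀(c_j·) = 0`, `φ₀(r) = r̄`, `φ₀(e_k) = X_k`, `φ₀(e_j) = 1`, `ker φ₀ = (c_j)`.
* For a prime `𝔴 ⊂ S` over `𝔪_R`, the FIBRE PRIME `𝔮 = φ₀(𝔴)` is prime and `a ∈ 𝔴 ⇔ φ₀ a ∈ 𝔮`.
* `exists_mul_fibreFace_mem_pow` [the transfer]: `L = S_𝔴` (the local ring of the near point), `T = F_𝔮`; the map
  `ψ : L → T` induced by `φ₀` sends `𝔪_L` into `𝔪_T`, `e₀ ↦ X₀`, `c_j ↦ 0`; so the K1-conclusion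
  `Φ_L ∈ (e₀, c_j) + 𝔪_Lⁿ` for the face element `Φ_S = G^{φ}(0, e₁, …, e_d)` becomes `Φ̄/1 ∈ (X₀) + 𝔪_Tⁿ` with
  `Φ̄ = Ḡ(fibreCoord)`, i.e. `s·Φ̄ ∈ (X₀) + 𝔮ⁿ` for some `s ∉ 𝔮` (clearing denominators), and finally — `X₀ ∈ 𝔮` at a near
  point and `Φ̄` does not involve `X₀` — `s'·Φ̄ ∈ 𝔮ⁿ` with `s' = Φ̄`-preserving kill of `X₀` applied to `s`.
* `fibre_hM`: the fibre reading of «the near point is not on the strict transform of the `i`-th listed curve».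

Sources: [CossartPiltant2008] proof of Prop. 4.2; [StacksProject, Tag 0804] (affine blow-up algebra and its
exceptional fibre), [StacksProject, Tag 00G3]; the tree's `Literature/AlgebraicGeometry/Resolution/BlowupChartRsop`.
-/

open IsLocalRing MvPolynomial
open Literature.AlgebraicGeometry.Resolution

namespace Summit.ResolutionOfSingularities.ResolutionOfSingularities.Theorems.NearExit

section Kill

variable {F : Type} [CommRing F]

/-- **Killing a generator of `𝔮`** (abstract form).  `κ₀ : F → F` a ring endomorphism with `κ₀ g ≡ g (mod x)`
for all `g`, `κ₀ x = 0`, `x ∈ 𝔮`; if `s ∉ 𝔮`, `κ₀ Φ = Φ` and `s·Φ ∈ (x) + 𝔮ⁿ` then `s'·Φ ∈ 𝔮ⁿ` for some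
`s' ∉ 𝔮` (namely `s' = κ₀ s`; any ideal `𝔮`). [folklore] -/
theorem exists_mul_mem_pow_of_kill (κ₀ : F →+* F) {x : F} (hκx : ∀ g, κ₀ g - g ∈ Ideal.span {x})
    (hκ0 : κ₀ x = 0) {𝔮 : Ideal F} (hx : x ∈ 𝔮) {s Φ : F} (hs : s ∉ 𝔮) (hfix : κ₀ Φ = Φ) {n : ℕ}
    (h : s * Φ ∈ Ideal.span {x} ⊔ 𝔮 ^ n) : ∃ s' : F, s' ∉ 𝔮 ∧ s' * Φ ∈ 𝔮 ^ n := by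
  have hXle : Ideal.span {x} ≤ 𝔮 := by
    rw [Ideal.span_le, Set.singleton_subset_iff]; exact hx
  have hmapq : ∀ g ∈ 𝔮, κ₀ g ∈ 𝔮 := by
    intro g hg
    have : κ₀ g = (κ₀ g - g) + g := by ring
    rw [this]
    exact Ideal.add_mem _ (hXle (hκx g)) hg
  have hmappow : ∀ g ∈ 𝔮 ^ n, κ₀ g ∈ 𝔮 ^ n := by
    intro g hg
    have h1 := Ideal.mem_map_of_mem κ₀ hg
    rw [Ideal.map_pow] at h1
    refine Ideal.pow_right_mono ?_ n h1
    rw [Ideal.map_le_iff_le_comap]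
    intro g hg
    exact hmapq g hg
  obtain ⟨a, ha, q, hq, haq⟩ := Submodule.mem_sup.mp h
  obtain ⟨b, rfl⟩ := Ideal.mem_span_singleton'.mp ha
  refine ⟨κ₀ s, fun hmem => hs ?_, ?_⟩
  · have : s = κ₀ s - (κ₀ s - s) := by ring
    rw [this]
    exact Ideal.sub_mem _ hmem (hXle (hκx s))
  · have h1 := congr_arg κ₀ haq
    rw [map_add, map_mul, map_mul, hfix, hκ0, mul_zero, zero_add] at h1
    rw [← h1]
    exact hmappow q hq

end Kill

section Clear

/-- **Clearing denominators**: `f/1 ∈ I·F_𝔮 ⇒ s·f ∈ I` for some `s ∉ 𝔮`. [cite: StacksProject, Tag 00G3] -/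
theorem exists_mul_mem_of_algebraMap_mem_map {F : Type} [CommRing F] {𝔮 : Ideal F} [𝔮.IsPrime]
    {T : Type} [CommRing T] [Algebra F T] [IsLocalization.AtPrime T 𝔮] {I : Ideal F} {f : F}
    (h : algebraMap F T f ∈ I.map (algebraMap F T)) : ∃ s : F, s ∉ 𝔮 ∧ s * f ∈ I := by
  rw [IsLocalization.mem_map_algebraMap_iff 𝔮.primeCompl T] at h
  obtain ⟨⟨⟨i, hi⟩, ⟨c, hc⟩⟩, hic⟩ := h
  simp only at hic
  rw [← map_mul] at hic
  obtain ⟨⟨e, he⟩, hee⟩ := IsLocalization.exists_of_eq (M := 𝔮.primeCompl) hic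
  simp only at hee
  refine ⟨e * c, fun hmem => ?_, ?_⟩
  · rcases ‹𝔮.IsPrime›.mem_or_mem hmem with h1 | h2
    · exact he h1
    · exact hc h2
  · have : e * c * f = e * (f * c) := by ring
    rw [this, hee]
    exact Ideal.mul_mem_left _ _ hi

/-- **Local transfer** (generic form).  `S → L = S_𝔴` a localisation at a prime, `φ₀ : S → F` with
`𝔴 = φ₀⁻¹(φ₀(𝔴)F)` and `φ₀(𝔴)F` prime, `φ₀ t = 0`; if `Φ ∈ (x₀, t) + 𝔪_Lⁿ` in `L` then
`s·φ₀(Φ) ∈ (φ₀ x₀) + (φ₀(𝔴)F)ⁿ` for some `s ∉ φ₀(𝔴)F` (map `L → F_{φ₀(𝔴)}` by the universal property and clear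
denominators). [cite: CossartPiltant2008, proof of Prop. 4.2] [cite: StacksProject, Tag 00G3] -/
theorem exists_mul_map_mem_of_local {S F L : Type} [CommRing S] [CommRing F] [CommRing L] [IsLocalRing L]
    [Algebra S L] (𝔴 : Ideal S) [𝔴.IsPrime] [IsLocalization.AtPrime L 𝔴] (φ₀ : S →+* F)
    (hφ : ∀ a, a ∈ 𝔴 ↔ φ₀ a ∈ 𝔴.map φ₀) [(𝔴.map φ₀).IsPrime] {x₀ t Φ : S} (ht : φ₀ t = 0) {n : ℕ}
    (hK1 : (algebraMap S L : S →+* L) Φ ∈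
      Ideal.span (Set.range (![(algebraMap S L : S →+* L) x₀, (algebraMap S L : S →+* L) t] : Fin 2 → L)) ⊔
        maximalIdeal L ^ n) :
    ∃ s : F, s ∉ 𝔴.map φ₀ ∧ s * φ₀ Φ ∈ Ideal.span {φ₀ x₀} ⊔ 𝔴.map φ₀ ^ n := by
  classical
  -- the localisation `T = F_𝔮` and `ψ : L → T`
  let T := Localization.AtPrime (𝔴.map φ₀)
  have hunits : ∀ y : 𝔴.primeCompl, IsUnit (((algebraMap F T).comp φ₀) y) := fun y =>
    IsLocalization.map_units T ⟨φ₀ y, show φ₀ y ∈ (𝔴.map φ₀).primeCompl from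
      fun hy => y.2 ((hφ y).mpr hy)⟩
  let ψ : L →+* T := IsLocalization.lift (M := 𝔴.primeCompl) hunits
  have hψ : ∀ a, ψ ((algebraMap S L : S →+* L) a) = algebraMap F T (φ₀ a) := fun a =>
    IsLocalization.lift_eq hunits a
  have hcomp : ψ.comp (algebraMap S L) = (algebraMap F T).comp φ₀ := IsLocalization.lift_comp hunits
  have hψm : Ideal.map ψ (maximalIdeal L) ≤ maximalIdeal T := by
    rw [← IsLocalization.AtPrime.map_eq_maximalIdeal 𝔴 L, Ideal.map_map, hcomp, ← Ideal.map_map,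
      IsLocalization.AtPrime.map_eq_maximalIdeal (𝔴.map φ₀) T]
  -- apply `ψ` to the K1 hypothesis
  obtain ⟨a, ha, b, hb, hab⟩ := Submodule.mem_sup.mp hK1
  obtain ⟨f, rfl⟩ := Ideal.mem_span_range_iff_exists_fun.mp ha
  have hT : algebraMap F T (φ₀ Φ) ∈ Ideal.map (algebraMap F T) (Ideal.span {φ₀ x₀} ⊔ 𝔴.map φ₀ ^ n) := by
    rw [← hψ, ← hab, map_add, Ideal.map_sup, Ideal.map_pow,
      IsLocalization.AtPrime.map_eq_maximalIdeal (𝔴.map φ₀) T, Ideal.map_span, Set.image_singleton]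
    refine Ideal.add_mem _ (Ideal.mem_sup_left ?_) (Ideal.mem_sup_right ?_)
    · rw [map_sum, Fin.sum_univ_two]
      have hv0 : (![(algebraMap S L : S →+* L) x₀, (algebraMap S L : S →+* L) t] : Fin 2 → L) 0 =
          (algebraMap S L : S →+* L) x₀ := Matrix.cons_val_zero _ _
      have hv1 : (![(algebraMap S L : S →+* L) x₀, (algebraMap S L : S →+* L) t] : Fin 2 → L) 1 =
          (algebraMap S L : S →+* L) t := by
        simp only [Matrix.cons_val_one, Matrix.cons_val_fin_one]
      rw [hv0, hv1, map_mul, map_mul, hψ, hψ, ht, map_zero, mul_zero, add_zero]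
      exact Ideal.mul_mem_left _ _ (Ideal.subset_span (Set.mem_singleton _))
    · exact Ideal.pow_right_mono hψm n (by rw [← Ideal.map_pow]; exact Ideal.mem_map_of_mem ψ hb)
  exact exists_mul_mem_of_algebraMap_mem_map (𝔮 := 𝔴.map φ₀) hT

/-- **Local transfer + kill** (abstract form): with a ring endomorphism `κ₀` of `F` killing `x = φ₀ x₀ ∈ φ₀(𝔴)F`
and fixing `Φ' = φ₀ Φ`, the conclusion of `exists_mul_map_mem_of_local` improves to `s·Φ' ∈ (φ₀(𝔴)F)ⁿ`.
[cite: CossartPiltant2008, proof of Prop. 4.2] -/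
theorem exists_mul_mem_pow_of_local_kill {S F L : Type} [CommRing S] [CommRing F] [CommRing L]
    [IsLocalRing L] [Algebra S L] (𝔴 : Ideal S) [𝔴.IsPrime] [IsLocalization.AtPrime L 𝔴] (φ₀ : S →+* F)
    (hφ : ∀ a, a ∈ 𝔴 ↔ φ₀ a ∈ 𝔴.map φ₀) [(𝔴.map φ₀).IsPrime] (κ₀ : F →+* F) {x : F}
    (hκx : ∀ g, κ₀ g - g ∈ Ideal.span {x}) (hκ0 : κ₀ x = 0) (hx : x ∈ 𝔴.map φ₀) {x₀ t Φ : S}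
    (hx₀ : φ₀ x₀ = x) (ht : φ₀ t = 0) {Φ' : F} (hΦ' : φ₀ Φ = Φ') (hfix : κ₀ Φ' = Φ') {n : ℕ}
    (hK1 : (algebraMap S L : S →+* L) Φ ∈
      Ideal.span (Set.range (![(algebraMap S L : S →+* L) x₀, (algebraMap S L : S →+* L) t] : Fin 2 → L)) ⊔
        maximalIdeal L ^ n) :
    ∃ s : F, s ∉ 𝔴.map φ₀ ∧ s * Φ' ∈ 𝔴.map φ₀ ^ n := by
  obtain ⟨s, hs, hsΦ⟩ := exists_mul_map_mem_of_local 𝔴 φ₀ hφ ht hK1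
  rw [hx₀, hΦ'] at hsΦ
  exact exists_mul_mem_pow_of_kill κ₀ hκx hκ0 hx hs hfix hsΦ

end Clear

section Transfer

variable {R : Type} [CommRing R] [IsLocalRing R] {d : ℕ} (c : Fin (d + 1) → R)
  (hc : Ideal.span (Set.range c) = maximalIdeal R) (hqr : IsQuasiRegular c) (j : Fin (d + 1))

variable {c} in
/-- `R/(c) ≅ κ(R)` (the centre is the closed point). DEFINITION (support, data). [folklore] -/
def resEquiv : R ⧸ Ideal.span (Set.range c) ≃+* ResidueField R :=
  Ideal.quotEquivOfEq hc

/-- **The fibre map `φ₀ : chartRing c j ↠ κ[X_k : k ≠ j]`** (reduction modulo the exceptional divisor `(c_j)`).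
DEFINITION (support, data). [cite: StacksProject, Tag 0804] -/
noncomputable def fibreMap : chartRing c j →+* MvPolynomial {k : Fin (d + 1) // k ≠ j} (ResidueField R) :=
  ((mapEquiv {k : Fin (d + 1) // k ≠ j} (resEquiv hc)).toRingHom.comp
    (chartQuotEquiv c j hqr).symm.toRingHom).comp (Ideal.Quotient.mk (Ideal.span {chartBase c j (c j)}))

/-- `φ₀` is surjective. [folklore] -/
theorem fibreMap_surjective : Function.Surjective (fibreMap c hc hqr j) :=
  ((mapEquiv {k : Fin (d + 1) // k ≠ j} (resEquiv hc)).surjective.comp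
    (chartQuotEquiv c j hqr).symm.surjective).comp Ideal.Quotient.mk_surjective

/-- Unfolding `φ₀`. [folklore] -/
theorem fibreMap_apply (a : chartRing c j) : fibreMap c hc hqr j a =
    mapEquiv {k : Fin (d + 1) // k ≠ j} (resEquiv hc)
      ((chartQuotEquiv c j hqr).symm (Ideal.Quotient.mk (Ideal.span {chartBase c j (c j)}) a)) :=
  rfl

/-- `φ₀(r) = r̄` on `R`. [folklore] -/
theorem fibreMap_chartBase (r : R) : fibreMap c hc hqr j (chartBase c j r) = C (residue R r) := by
  have h1 : (chartQuotEquiv c j hqr).symm (Ideal.Quotient.mk _ (chartBase c j r)) =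
      C (Ideal.Quotient.mk _ r) := by
    rw [RingEquiv.symm_apply_eq, chartQuotEquiv_apply, chartQuotMap_C]
  rw [fibreMap_apply, h1, mapEquiv_apply, map_C]
  rfl

/-- `φ₀(e_k) = X_k` for `k ≠ j`. [folklore] -/
theorem fibreMap_chartGen {k : Fin (d + 1)} (hk : k ≠ j) : fibreMap c hc hqr j (chartGen c j k) = X ⟨k, hk⟩ := by
  have h1 : (chartQuotEquiv c j hqr).symm (Ideal.Quotient.mk _ (chartGen c j k)) =
      (X ⟨k, hk⟩ : MvPolynomial {k : Fin (d + 1) // k ≠ j} (R ⧸ Ideal.span (Set.range c))) := by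
    rw [RingEquiv.symm_apply_eq, chartQuotEquiv_apply, chartQuotMap_X]
  rw [fibreMap_apply, h1, mapEquiv_apply, map_X]

/-- `φ₀(e_j) = 1`. [folklore] -/
theorem fibreMap_chartGen_self : fibreMap c hc hqr j (chartGen c j j) = 1 := by
  have h1 : chartGen c j j = 1 := chartGen_self c j
  rw [h1, map_one]

/-- `φ₀(c_j) = 0`. [folklore] -/
theorem fibreMap_chartBase_self : fibreMap c hc hqr j (chartBase c j (c j)) = 0 := by
  rw [fibreMap_apply, Ideal.Quotient.eq_zero_iff_mem.mpr (Ideal.mem_span_singleton_self _), map_zero, map_zero]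

/-- `ker φ₀ = (c_j)`. [folklore] -/
theorem mem_ker_fibreMap_iff (a : chartRing c j) :
    fibreMap c hc hqr j a = 0 ↔ a ∈ Ideal.span {chartBase c j (c j)} := by
  rw [fibreMap_apply, map_eq_zero_iff _ (RingEquiv.injective _), map_eq_zero_iff _ (RingEquiv.injective _),
    Ideal.Quotient.eq_zero_iff_mem]

/-- `φ₀` of the chart face element `G^{φ}(0, e₁, …, e_d)` is the fibre face form `Ḡ(fibreCoord)`.
[cite: CossartPiltant2008, proof of Prop. 4.2] -/
theorem fibreMap_face (hj : j ≠ 0) (G : MvPolynomial (Fin (d + 1)) R) :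
    fibreMap c hc hqr j (eval (Function.update (chartGen c j) 0 0) (map (chartBase c j) G)) =
      aeval (fibreCoord (ResidueField R) j) (map (residue R) G) := by
  rw [map_eval_eq_eval_map, map_map]
  have hcomp : (fibreMap c hc hqr j).comp (chartBase c j) = C.comp (residue R) :=
    RingHom.ext fun r => fibreMap_chartBase c hc hqr j r
  have hv : (fibreMap c hc hqr j) ∘ Function.update (chartGen c j) 0 0 = fibreCoord (ResidueField R) j := by
    funext k
    by_cases hk0 : k = 0
    · subst hk0; simp [fibreCoord]
    · by_cases hkj : k = j
      · subst hkj
        simp [fibreCoord, hk0, fibreMap_chartGen_self]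
      · simp [fibreCoord, hk0, hkj, fibreMap_chartGen c hc hqr j hkj]
  rw [hcomp, hv, eval_map, aeval_def, eval₂_map]
  rfl

/-- **The kill map** `κ₀ : X₀ ↦ 0` on `κ(y)[X_k : k ≠ j]`. DEFINITION (support, data). [folklore] -/
noncomputable def killMap (hj : j ≠ 0) :
    MvPolynomial {k : Fin (d + 1) // k ≠ j} (ResidueField R) →+*
      MvPolynomial {k : Fin (d + 1) // k ≠ j} (ResidueField R) :=
  (aeval fun k : {k : Fin (d + 1) // k ≠ j} =>
    if k = ⟨0, Ne.symm hj⟩ then (0 : MvPolynomial {k : Fin (d + 1) // k ≠ j} (ResidueField R)) else X k).toRingHom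

/-- Unfolding `κ₀`. [folklore] -/
theorem killMap_apply (hj : j ≠ 0) (g : MvPolynomial {k : Fin (d + 1) // k ≠ j} (ResidueField R)) :
    killMap (R := R) j hj g = aeval (fun k : {k : Fin (d + 1) // k ≠ j} =>
      if k = ⟨0, Ne.symm hj⟩ then (0 : MvPolynomial {k : Fin (d + 1) // k ≠ j} (ResidueField R)) else X k) g :=
  rfl

/-- `κ₀ g ≡ g (mod X₀)`. [folklore] -/
theorem killMap_sub_mem (hj : j ≠ 0) (g : MvPolynomial {k : Fin (d + 1) // k ≠ j} (ResidueField R)) :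
    killMap (R := R) j hj g - g ∈
      Ideal.span {(X ⟨0, Ne.symm hj⟩ : MvPolynomial {k : Fin (d + 1) // k ≠ j} (ResidueField R))} := by
  have h1 := aeval_sub_aeval_mem_span g (fun k : {k : Fin (d + 1) // k ≠ j} =>
    if k = ⟨0, Ne.symm hj⟩ then (0 : MvPolynomial {k : Fin (d + 1) // k ≠ j} (ResidueField R)) else X k) X
    ⟨0, Ne.symm hj⟩ (fun k hk => by simp [hk])
  have e1 : ((fun k : {k : Fin (d + 1) // k ≠ j} =>
      if k = ⟨0, Ne.symm hj⟩ then (0 : MvPolynomial {k : Fin (d + 1) // k ≠ j} (ResidueField R)) else X k)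
        ⟨0, Ne.symm hj⟩ - X ⟨0, Ne.symm hj⟩) = -X ⟨0, Ne.symm hj⟩ := by simp
  have e2 : aeval (X : {k : Fin (d + 1) // k ≠ j} → MvPolynomial {k : Fin (d + 1) // k ≠ j} (ResidueField R))
      g = g := by simp
  rw [e1, e2, Ideal.span_singleton_neg] at h1
  exact h1

/-- `κ₀ X₀ = 0`. [folklore] -/
theorem killMap_X0 (hj : j ≠ 0) :
    killMap (R := R) j hj (X ⟨0, Ne.symm hj⟩) = 0 := by
  rw [killMap_apply, aeval_X, if_pos rfl]

/-- The kill map fixes the fibre face form (which does not involve `X₀`). [folklore] -/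
theorem killMap_fibreFace (hj : j ≠ 0) (G : MvPolynomial (Fin (d + 1)) R) :
    killMap (R := R) j hj (aeval (fibreCoord (ResidueField R) j) (map (residue R) G)) =
      aeval (fibreCoord (ResidueField R) j) (map (residue R) G) := by
  rw [killMap_apply, ← AlgHom.comp_apply, comp_aeval]
  have hfun : (fun i => aeval (fun k : {k : Fin (d + 1) // k ≠ j} =>
      if k = ⟨0, Ne.symm hj⟩ then (0 : MvPolynomial {k : Fin (d + 1) // k ≠ j} (ResidueField R)) else X k)
        (fibreCoord (ResidueField R) j i)) = fibreCoord (ResidueField R) j := by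
    funext k
    by_cases hk0 : k = 0
    · subst hk0; simp [fibreCoord]
    · by_cases hkj : k = j
      · subst hkj; simp [fibreCoord, hk0]
      · simp [fibreCoord, hk0, hkj]
  rw [hfun]

variable (𝔴 : Ideal (chartRing c j)) [h𝔴p : 𝔴.IsPrime] (h𝔴 : 𝔴.comap (chartBase c j) = maximalIdeal R)

include hc h𝔴 in
omit h𝔴p in
/-- `(c_j) = ker φ₀ ⊆ 𝔴`. [folklore] -/
theorem span_le_of_over : Ideal.span {chartBase c j (c j)} ≤ 𝔴 := by
  rw [Ideal.span_le, Set.singleton_subset_iff, SetLike.mem_coe, ← Ideal.mem_comap, h𝔴, ← hc]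
  exact Ideal.subset_span (Set.mem_range_self j)

include h𝔴 in
/-- **The fibre prime `𝔮 = φ₀(𝔴)` is prime.** [folklore] -/
theorem isPrime_fibrePrime : (𝔴.map (fibreMap c hc hqr j)).IsPrime :=
  Ideal.map_isPrime_of_surjective (fibreMap_surjective c hc hqr j) fun a ha =>
    span_le_of_over c hc j 𝔴 h𝔴 ((mem_ker_fibreMap_iff c hc hqr j a).mp ha)

include h𝔴 in
omit h𝔴p in
/-- `a ∈ 𝔴 ⇔ φ₀ a ∈ 𝔮`. [folklore] -/
theorem mem_iff_fibreMap_mem (a : chartRing c j) : a ∈ 𝔴 ↔ fibreMap c hc hqr j a ∈ 𝔴.map (fibreMap c hc hqr j) := by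
  rw [← Ideal.mem_comap, Ideal.comap_map_of_surjective _ (fibreMap_surjective c hc hqr j),
    sup_eq_left.mpr fun a ha => span_le_of_over c hc j 𝔴 h𝔴 ((mem_ker_fibreMap_iff c hc hqr j a).mp ha)]

include h𝔴 in
/-- **The transfer.**  See the module docstring. [cite: CossartPiltant2008, proof of Prop. 4.2] -/
theorem exists_mul_fibreFace_mem_pow (L : Type) [CommRing L] [IsLocalRing L] [Algebra (chartRing c j) L]
    [IsLocalization.AtPrime L 𝔴] (hj : j ≠ 0) (he0 : chartGen c j 0 ∈ 𝔴) (G : MvPolynomial (Fin (d + 1)) R)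
    (n : ℕ)
    (hK1 : (algebraMap (chartRing c j) L : chartRing c j →+* L)
        (MvPolynomial.eval (Function.update (chartGen c j) 0 0) (MvPolynomial.map (chartBase c j) G)) ∈
      Ideal.span (Set.range (![(algebraMap (chartRing c j) L : chartRing c j →+* L) (chartGen c j 0),
        (algebraMap (chartRing c j) L : chartRing c j →+* L) (chartBase c j (c j))] : Fin 2 → L)) ⊔
        maximalIdeal L ^ n) :
    ∃ s : MvPolynomial {k : Fin (d + 1) // k ≠ j} (ResidueField R), s ∉ 𝔴.map (fibreMap c hc hqr j) ∧
      s * aeval (fibreCoord (ResidueField R) j) (map (residue R) G) ∈ 𝔴.map (fibreMap c hc hqr j) ^ n := by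
  haveI h𝔮 : (𝔴.map (fibreMap c hc hqr j)).IsPrime := isPrime_fibrePrime c hc hqr j 𝔴 h𝔴
  have hX0 : (X ⟨0, Ne.symm hj⟩ : MvPolynomial {k : Fin (d + 1) // k ≠ j} (ResidueField R)) ∈
      𝔴.map (fibreMap c hc hqr j) := by
    rw [← fibreMap_chartGen c hc hqr j (Ne.symm hj)]
    exact (mem_iff_fibreMap_mem c hc hqr j 𝔴 h𝔴 _).mp he0
  exact exists_mul_mem_pow_of_local_kill 𝔴 (fibreMap c hc hqr j) (mem_iff_fibreMap_mem c hc hqr j 𝔴 h𝔴)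
    (killMap j hj) (killMap_sub_mem j hj) (killMap_X0 j hj) hX0 (fibreMap_chartGen c hc hqr j (Ne.symm hj))
    (fibreMap_chartBase_self c hc hqr j) (fibreMap_face c hc hqr j hj G) (killMap_fibreFace j hj G) hK1

include h𝔴 in
omit h𝔴p in
/-- **Fibre reading of «not on the strict transform of the `i`-th listed curve».**  If `w̄_{ij} ≠ 0` and NOT all
`e_k w_{ij} - w_{ik}` lie in `𝔴`, then some `X_k w̄_{ij} - w̄_{ik}` is not in `𝔮`. [folklore] -/
theorem fibre_hM {m : ℕ} (w : Fin m → Fin (d + 1) → R) (i : Fin m)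
    (hR : ¬ ∀ k, chartGen c j k * chartBase c j (w i j) - chartBase c j (w i k) ∈ 𝔴)
    (hij : residue R (w i j) ≠ 0) :
    ∃ k : {k : Fin (d + 1) // k ≠ j}, X k * C (residue R (w i j)) - C (residue R (w i k.1)) ∉
      𝔴.map (fibreMap c hc hqr j) := by
  push Not at hR
  obtain ⟨k, hk⟩ := hR
  by_cases hkj : k = j
  · subst hkj
    have h1 : chartGen c k k = 1 := chartGen_self c k
    have h0 : chartGen c k k * chartBase c k (w i k) - chartBase c k (w i k) = 0 := by rw [h1]; ring
    rw [h0] at hk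
    exact absurd (Ideal.zero_mem _) hk
  · refine ⟨⟨k, hkj⟩, fun hmem => hk ((mem_iff_fibreMap_mem c hc hqr j 𝔴 h𝔴 _).mpr ?_)⟩
    have e1 := map_sub (fibreMap c hc hqr j) (chartGen c j k * chartBase c j (w i j)) (chartBase c j (w i k))
    have e2 := map_mul (fibreMap c hc hqr j) (chartGen c j k) (chartBase c j (w i j))
    have e : fibreMap c hc hqr j (chartGen c j k * chartBase c j (w i j) - chartBase c j (w i k)) =
        X ⟨k, hkj⟩ * C (residue R (w i j)) - C (residue R (w i k)) := by
      refine e1.trans ?_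
      refine (congrArg (fun z => z - fibreMap c hc hqr j (chartBase c j (w i k))) e2).trans ?_
      rw [fibreMap_chartGen c hc hqr j hkj, fibreMap_chartBase, fibreMap_chartBase]
    exact e ▸ hmem

end Transfer

end Summit.ResolutionOfSingularities.ResolutionOfSingularities.Theorems.NearExit
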